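import Literature.RingTheory.Nullstellensatz.PerronTheorem
import HarnessLib

/-!
# Perron's theorem, sharp form (degree `∏ δᵢ / min δᵢ`) — NAMED FACT

O. Perron, *Algebra I (Die Grundlagen)* (1927), Satz 57; A. Płoski, *Algebraic dependence of
polynomials after O. Perron and some applications* (2005), Thm. 1.1; as printed in M. Beecken,
J. Mittmann, N. Saxena, *Algebraic independence and blackbox identity testing*, Inform. and
Comput. 222 (2013) (= arXiv:1102.2789), **Thm. 4 (Perron's theorem) [Plo05]:** «Let
`f_i ∈ K[x]` be a polynomial of degree `δ_i ≥ 1`, for `i ∈ [n+1]`. Then there exists a non-zero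
polynomial `F ∈ K[y_1, …, y_{n+1}]` such that `F(f_1, …, f_{n+1}) = 0` and
`deg(F) ≤ (∏_i δ_i) / min_i{δ_i}`.» (`K` an arbitrary field, `K[x] = K[x_1, …, x_n]`.)

The tree PROVES the weak form `deg F ≤ (n+1)(2δ(n+1))^n` by the bare dimension count
(`exists_algRelation_of_totalDegree_le`, file `PerronTheorem`); the sharp bound (Płoski: the
weighted degree `deg_w F ≤ ∏ δ_i` for the weights `w_i = δ_i`, whence `deg F · min δ_i ≤ ∏ δ_i`)
rests on Bézout-type degree theory (`[K(x) : K(f)] ≤ ∏ δ_i`) that the tree does not have, so it is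
vendored here as a named fact (D-0014).  It is the degree bound behind the positive-characteristic
clause `char K > δ^r` of the Jacobian criterion [BMS13, Thm. 6] (= FSV 2018 Fact 51,
`Literature.Computability.AlgebraicComplexity.ForbesShpilkaVolk2018_fact51`).

Rendering: the printed `deg(F) ≤ (∏ δ_i)/min δ_i` is typed as `deg(F) · m ≤ ∏ δ_i` for every
common lower bound `1 ≤ m ≤ δ_i` of the degrees (equivalent: `m = min δ_i` is the printed bound,
smaller `m` are weaker); `δ_i = deg f_i` exactly (`totalDegree`), `n + 1` polynomials in the `n`
variables `Fin n`, indexed by `Fin (n + 1)` as printed.  (The reindexed corollary for families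
`Option ι → K[ι]` — the shape in which the Jacobian criterion consumes it — is proved in
`Literature/Computability/AlgebraicComplexity/FSV18JacobianCriterionPosChar.lean`.)

## References
* [Perron1927] O. Perron, *Algebra I (Die Grundlagen)*, de Gruyter (1927), Satz 57.
* [Ploski2005] A. Płoski, in: Computational Commutative and Non-Commutative Algebraic Geometry,
  IOS Press (2005), 167–173, Thm. 1.1.
* [BeeckenMittmannSaxena2013] Thm. 4 (arXiv:1102.2789 p. 5), the statement as typed here.
-/

noncomputable section

open MvPolynomial

namespace Literature.RingTheory.Nullstellensatz

/-- **Perron's theorem (sharp form) — NAMED FACT.** «Let `f_i ∈ K[x_1, …, x_n]` be a polynomial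
of degree `δ_i ≥ 1`, for `i ∈ [n+1]`. Then there exists a non-zero polynomial
`F ∈ K[y_1, …, y_{n+1}]` such that `F(f_1, …, f_{n+1}) = 0` and `deg(F) ≤ (∏_i δ_i)/min_i{δ_i}`»
(any field `K`).  Typed with `deg(F) · m ≤ ∏_i δ_i` for every `m` with `1 ≤ m ≤ δ_i` (all `i`),
which for `m = min δ_i` is the printed bound.
[cite: BeeckenMittmannSaxena2013, Thm. 4; Ploski2005, Thm. 1.1; Perron1927, Satz 57]
locator: paper:arxiv-1102.2789 p0005.txt:L31–L35 -/
-- FACT (X-class: Bézout-type degree theory; the weak form is PROVED in `PerronTheorem`)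
def perronTheorem_sharp : Prop :=
  ∀ (K : Type) [Field K] (n : ℕ) (f : Fin (n + 1) → MvPolynomial (Fin n) K) (m : ℕ),
    1 ≤ m → (∀ i, m ≤ (f i).totalDegree) →
      ∃ F : MvPolynomial (Fin (n + 1)) K, F ≠ 0 ∧ aeval f F = 0 ∧
        F.totalDegree * m ≤ ∏ i, (f i).totalDegree

end Literature.RingTheory.Nullstellensatz

end
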